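import Summits.BirchSwinnertonDyer.BirchSwinnertonDyer.Theorems.ThetaPartnerAtTwoSignedKatoUpToAtTwoLocalTowerResInjective
import Summits.BirchSwinnertonDyer.BirchSwinnertonDyer.Theorems.ThetaPartnerAtTwoSignedControlAtTwoPlusKimSignedUnion
import Literature.NumberTheory.EllipticCurves.PeriodIndexCorestrictionLocal
import HarnessLib

/-!
# Route `ThetaPartnerAtTwo` (TP2), crux K3 `SignedKatoDivisibilityUpToAtTwo` (item stmt-BirchSwinnertonDyer-20308) /
# K3P′ `SignedKatoDivisibilityUpToAtTwoOfPub` (item 25631), line `colemanrat` v7 — a brick for the (PT-orth) clause of the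
# research stub (R2c): the Kummer WITNESS of a class of `Sel^ε(E/ℚ_∞)` DESCENDS, POINTWISE, to a layer representative

Lead `bsd-wall-tp2-p2x` g5 (cell `bsd-wall`). HONEST FRAMING: THEOREMS ONLY (no definition, no named fact, no instance, no `sorry`);
closes no item; BSD is NOT proved by any of this.

Why. The clause (PT-orth) of `Cruxes.SignedKatoDivisibilityUpToAtTwo.ColemanRat.stub_layerSideTwoInv` speaks of a class
`t ∈ Sel⁺(E/ℚ_∞) ⊆ H¹(Gal(ℚ̄/ℚ_∞), E[2^∞])` through a KUMMER WITNESS `(φ, Q, k)` OVER `ℚ_∞`: a crossed homomorphism `φ`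
representing `t` with `ι φ(τ|_ℚ̄) = τQ − Q` for all `τ ∈ Gal(ℚ̄_v/ℚ_∞·ℚ_v)`. Poitou–Tate is a theorem about a FINITE layer
`ℚ_N`: one needs a layer class `t_N ∈ Sel⁺(E/ℚ_N)` restricting to `t` (`Sel⁺(E/ℚ_∞) = ⋃ₙ res Sel⁺(E/ℚ_n)`, tree
`SignedEC.exists_layer_of_mem_signedSelmerInfty`) AND a description of its localisation at the prime of `ℚ_N` above `2`. This
file proves that the witness descends ON THE NOSE: for EVERY crossed homomorphism `φ_N` on `Γ_N = Gal(ℚ̄/ℚ_N)` representing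
`t_N` there is a torsion point `R ∈ E[2^∞](ℚ̄)` such that

  `ι φ_N(τ|_ℚ̄) = τ(Q − ιR) − (Q − ιR)`  for ALL `τ ∈ Gal(ℚ̄_v/ℚ_N·ℚ_v)`,

i.e. the localisation of `t_N` at `𝔭 ∣ 2` IS the Kummer cocycle of the point `Q − ιR` (with `2^k(Q − ιR) ∈ E(ℚ_N·ℚ_v)` as
soon as `2^k Q ∈ E(ℚ_N·ℚ_v)` and `2^k R = 0`) — an identity of FUNCTIONS, so that it can be fed to any model of the layer-`N`
local Tate pairing (the (D-layer) definition item: cup product with `WeierstrassCurve.subgroupKummerCocycle`, in the subgroup or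
in the Shapiro model). Mechanism: on `Gal(ℚ̄/ℚ_∞)` the two cocycles `φ` and `φ_N ∘ incl` differ by a principal crossed
homomorphism `g ↦ gR − R` (same class); so the crossed homomorphism `δ(τ) = ι φ_N(τ) − (τ Q' − Q')`, `Q' = Q − ιR`, on
`U_N = Gal(ℚ̄_v/ℚ_N·ℚ_v)` VANISHES on the normal subgroup `U_∞ = Gal(ℚ̄_v/ℚ_∞·ℚ_v)`; a crossed homomorphism vanishing on a
normal subgroup takes values in its fixed points (§1, pure algebra); `δ` is torsion-valued and `E(ℚ_{2,∞}·ℚ_v)` has NO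
`2`-power torsion at a good supersingular `2` (tree: `SignedKatoOffTwo.LocalTowerRes.eq_zero_of_mem_localTowerPointsOfEmb_of_pow_nsmul_two`,
Kobayashi Prop. 8.7), so `δ = 0`.

## What is proved
* §1 `smul_eq_self_of_crossedHom_of_forall_mem_eq_zero` — a crossed homomorphism on a group `U` that vanishes on a normal subgroup
  `V` takes `V`-fixed values (any `DistribMulAction`).
* §2 `exists_pow_nsmul_apply_eq_zero_of_compactSpace` — a continuous crossed homomorphism on a COMPACT group with values in
  `E[p^∞](K̄)` is killed by one power of `p` (finite image).
* §3 `exists_torsion_kummerWitness_layer` (any number field `K`, prime `p`, `ℤ_p`-extension, `K`-field `E`, embedding `ι`, under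
  the hypothesis «`E(K_∞·K_v)` has no `p`-power torsion»): the pointwise descent displayed above.
* §4 `exists_signedSelmerLayer_kummerWitness_two` — the packaged form for `W/ℚ` globally minimal with `GoodSS W 2`, `v ∋ 2`, any
  sign `ε`: for `t ∈ Sel^ε(E/ℚ_∞)` with a Kummer witness `(φ, Q)` over `ℚ_∞` and any `n₀`, `k` with `2^k Q ∈ E(ℚ_{n₀}·ℚ_v)`, there are
  `N ≥ n₀` and `t_N ∈ Sel^ε(E/ℚ_N)` with `res t_N = t` such that EVERY crossed homomorphism `φ_N` of class `t_N` is killed by one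
  power of `2` and satisfies the pointwise identity on `Gal(ℚ̄_v/ℚ_N·ℚ_v)` for some `2`-power torsion point `R ∈ E(ℚ̄)`.

References: [Kobayashi2003] Def. 1.1 (p. 2), (7.16)–(7.21) (p. 12), Prop. 8.7 (p. 16), (8.23) (p. 18); [GreenbergLNM1716] §3 Lemma 3.1 (p. 86);
[SerreGaloisCohomology1997] I §2.2, I §5.1 (crossed homomorphisms), I §2.6 (b); [MilneADT2006] I §6 (the local Kummer sequence).
-/

set_option autoImplicit false
-- the Theorems namespace of this sub repeats the summit name by design (D-0017 nested layout)
set_option linter.dupNamespace false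

noncomputable section

open scoped Classical

namespace Summit.BirchSwinnertonDyer.BirchSwinnertonDyer.Theorems

namespace SignedKatoOffTwo.LayerWitness

open NumberField IsDedekindDomain Field WeierstrassCurve
  Literature.NumberTheory.EllipticCurves Literature.NumberTheory.EllipticCurves.Kobayashi2003
  Literature.NumberTheory.EllipticCurves.GreenbergSelmer
  Literature.NumberTheory.EllipticCurves.Sprung2012 Literature.NumberTheory.GaloisRepresentations ZpExtension

universe u

/-! ## §1 Crossed homomorphisms vanishing on a normal subgroup -/

section Algebra

variable {U : Type*} [Group U] {M : Type*} [AddCommGroup M] [DistribMulAction U M]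

/-- **A crossed homomorphism vanishing on a normal subgroup takes values in its fixed points**: if `δ : U → M` satisfies
`δ(ab) = δ(a) + a • δ(b)` and `δ|_V = 0` for a normal subgroup `V`, then `v • δ(u) = δ(u)` for all `v ∈ V`, `u ∈ U`
(`δ(vu) = v • δ(u)` and `δ(vu) = δ(u · u⁻¹vu) = δ(u)`). This is the cocycle computation behind the exactness of
inflation–restriction at `H¹(U/V, M^V)`. [cite: SerreGaloisCohomology1997, I §2.6 (b) and I §5.1] -/
theorem smul_eq_self_of_crossedHom_of_forall_mem_eq_zero (V : Subgroup U) [V.Normal] (δ : U → M)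
    (hδ : ∀ a b : U, δ (a * b) = δ a + a • δ b) (hV : ∀ v ∈ V, δ v = 0) (u : U) {v : U} (hv : v ∈ V) :
    v • δ u = δ u := by
  have h1 : δ (v * u) = v • δ u := by rw [hδ, hV v hv, zero_add]
  have hmem : u⁻¹ * v * u ∈ V := by
    have := Subgroup.Normal.conj_mem inferInstance v hv u⁻¹
    simpa [mul_assoc] using this
  have h2 : δ (v * u) = δ u := by
    have e : v * u = u * (u⁻¹ * v * u) := by group
    rw [e, hδ, hV _ hmem, smul_zero, add_zero]
  rw [← h1, h2]

end Algebra

/-! ## §2 A continuous crossed homomorphism on a compact group into `E[p^∞]` is killed by one power of `p` -/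

section Compact

variable {K : Type u} [Field K] (W : WeierstrassCurve K) (p : ℕ)
  {H : Type u} [Group H] [TopologicalSpace H] [CompactSpace H]
  [DistribMulAction H (W.geomPrimaryTorsion p)]

/-- **Uniform exponent**: a continuous crossed homomorphism `f` on a compact group with values in the discrete module `E[p^∞](K̄)`
has finite image, hence `p^K • f(x) = 0` for one `K` and all `x`. [cite: SerreGaloisCohomology1997, I §2.2 (continuous cochains with
discrete coefficients are locally constant)] -/
theorem exists_pow_nsmul_apply_eq_zero_of_compactSpace
    (f : contOneCocycles (discreteTopRep H (W.geomPrimaryTorsion p))) :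
    ∃ K : ℕ, ∀ x : H, (p ^ K : ℕ) • ((f.1 x : W.geomPrimaryTorsion p) : W.geomPoints) = 0 := by
  have hfin : (Set.range f.1).Finite := (isCompact_range f.1.continuous).finite_of_discrete
  let e : W.geomPrimaryTorsion p → ℕ := fun m ↦ ((AddCommGroup.mem_primaryComponent).1 m.2).choose
  have he : ∀ m : W.geomPrimaryTorsion p, (p ^ e m : ℕ) • (m : W.geomPoints) = 0 := fun m ↦
    ((AddCommGroup.mem_primaryComponent).1 m.2).choose_spec
  refine ⟨hfin.toFinset.sup e, fun x ↦ ?_⟩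
  have hle : e (f.1 x) ≤ hfin.toFinset.sup e := Finset.le_sup (hfin.mem_toFinset.mpr ⟨x, rfl⟩)
  obtain ⟨d, hd⟩ := Nat.exists_eq_add_of_le hle
  rw [hd, pow_add, mul_nsmul, he, nsmul_zero]

end Compact

/-! ## §3 Pointwise descent of a Kummer witness to a layer representative -/

section Descent

variable {K : Type u} [Field K] [NumberField K] (W : WeierstrassCurve K) [W.IsElliptic] {p : ℕ} [hp : Fact p.Prime]
  (κ : ZpExtension K p) {E : Type u} [Field E] [Algebra K E] (ι : AlgebraicClosure K →ₐ[K] AlgebraicClosure E)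

omit [NumberField K] [W.IsElliptic] in
/-- **Pointwise descent of a Kummer witness to a layer.** Let `t_N ∈ H¹(Γ_N, E[p^∞])` restrict to `t ∈ H¹(Gal(K̄/K_∞), E[p^∞])`
(`layerToInfty`), let `φ_N`, `φ` be continuous crossed homomorphisms representing them, and let `Q ∈ E(K̄_E)` be a Kummer witness of
`φ` over `K_∞` at the embedding `ι` (`ι φ(τ|_K̄) = τQ − Q` on `Gal(K̄_E/K_∞·E)`) with `p^k Q ∈ E(K_N·E)`. If `E(K_∞·E)` has no
`p`-power torsion, then for some `R ∈ E[p^∞](K̄)`: `ι φ_N(τ|_K̄) = τ(Q − ιR) − (Q − ιR)` for ALL `τ ∈ Gal(K̄_E/K_N·E)`.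
[cite: Kobayashi2003, Def. 1.1 (p. 2), (8.23) (p. 18)] [cite: SerreGaloisCohomology1997, I §5.1, I §2.6 (b)] -/
theorem exists_torsion_kummerWitness_layer
    (hTF : ∀ P ∈ localTowerPointsOfEmb κ ι W, ∀ j : ℕ, (p ^ j : ℕ) • P = 0 → P = 0)
    {N : ℕ} (φN : contOneCocycles (discreteTopRep (κ.layerSubgroup N) (W.geomPrimaryTorsion p)))
    (φ : contOneCocycles (discreteTopRep κ.kerSubgroup (W.geomPrimaryTorsion p)))
    (hres : W.layerToInfty κ N (oneCocycleClass _ φN) = oneCocycleClass _ φ)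
    (Q : localPoints W E) (k : ℕ) (hQN : (p ^ k : ℕ) • Q ∈ localLayerPointsOfEmb κ ι W N)
    (hw : ∀ τ : localSubgroupOfEmb κ.kerSubgroup ι,
      pointsMapOfEmb W ι ((φ.1 (resGalSubgroupOfEmb κ.kerSubgroup ι τ) : W.geomPrimaryTorsion p) : W.geomPoints) =
        (τ : absoluteGaloisGroup E) • Q - Q) :
    ∃ R : W.geomPrimaryTorsion p,
      ∀ τ : localSubgroupOfEmb (κ.layerSubgroup N) ι,
        pointsMapOfEmb W ι ((φN.1 (resGalSubgroupOfEmb (κ.layerSubgroup N) ι τ) : W.geomPrimaryTorsion p) : W.geomPoints) =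
          (τ : absoluteGaloisGroup E) • (Q - pointsMapOfEmb W ι (R : W.geomPoints)) -
            (Q - pointsMapOfEmb W ι (R : W.geomPoints)) := by
  haveI : NeZero p := ⟨hp.out.ne_zero⟩
  -- (1) on `ker κ`, `φ - φ_N ∘ incl` is principal: `φ g = φ_N g + g • R - R`
  have hle : κ.kerSubgroup ≤ κ.layerSubgroup N := κ.kerSubgroup_le_layerSubgroup N
  set pb : contOneCocycles (discreteTopRep κ.kerSubgroup (W.geomPrimaryTorsion p)) :=
    contOneCocycles.pullback (subgroupInclusion hle)
      (resHomOfEquivariant (subgroupInclusion hle) (AddMonoidHom.id (W.geomPrimaryTorsion p)) fun _ _ ↦ rfl) φN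
    with hpb
  have hclass : oneCocycleClass _ (φ - pb) = 0 := by
    rw [oneCocycleClass_sub, sub_eq_zero, ← hres, hpb]
    change resH1Hom (subgroupInclusion hle) (AddMonoidHom.id (W.geomPrimaryTorsion p)) (fun _ _ ↦ rfl)
        (oneCocycleClass _ φN) = _
    exact resH1Hom_oneCocycleClass (subgroupInclusion hle) (AddMonoidHom.id (W.geomPrimaryTorsion p))
      (fun _ _ ↦ rfl) φN
  obtain ⟨R, hR⟩ := (oneCocycleClass_eq_zero_iff _ (φ - pb)).1 hclass
  refine ⟨R, ?_⟩
  -- values of `φ` on `ker κ`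
  have hφ : ∀ g : κ.kerSubgroup,
      ((φ.1 g : W.geomPrimaryTorsion p) : W.geomPoints) =
        ((φN.1 (subgroupInclusion hle g) : W.geomPrimaryTorsion p) : W.geomPoints) +
          ((g : absoluteGaloisGroup K) • (R : W.geomPoints) - (R : W.geomPoints)) := by
    intro g
    have h := hR g
    have h' : (φ.1 g : W.geomPrimaryTorsion p) - φN.1 (subgroupInclusion hle g) = g • R - R := h
    rw [sub_eq_iff_eq_add'] at h'
    rw [h', AddMemClass.coe_add, AddSubgroupClass.coe_sub, primaryComponent.coe_smul]
    rfl
  -- notation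
  obtain ⟨R', hR'⟩ : ∃ R' : localPoints W E, R' = pointsMapOfEmb W ι (R : W.geomPoints) := ⟨_, rfl⟩
  obtain ⟨Q', hQ'⟩ : ∃ Q' : localPoints W E, Q' = Q - R' := ⟨_, rfl⟩
  let UN : Subgroup (absoluteGaloisGroup E) := localSubgroupOfEmb (κ.layerSubgroup N) ι
  let Uinf : Subgroup (absoluteGaloisGroup E) := localSubgroupOfEmb κ.kerSubgroup ι
  have hUle : Uinf ≤ UN := fun τ hτ ↦ by
    rw [mem_localSubgroupOfEmb_iff] at hτ ⊢
    exact hle hτ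
  -- the crossed homomorphism `δ` on `U_N`
  let δ : UN → localPoints W E := fun τ ↦
    pointsMapOfEmb W ι ((φN.1 (resGalSubgroupOfEmb (κ.layerSubgroup N) ι τ) : W.geomPrimaryTorsion p) : W.geomPoints) -
      ((τ : absoluteGaloisGroup E) • Q' - Q')
  have hδ_cross : ∀ a b : UN, δ (a * b) = δ a + a • δ b := by
    intro a b
    have hcoc := φN.2 (resGalSubgroupOfEmb (κ.layerSubgroup N) ι a) (resGalSubgroupOfEmb (κ.layerSubgroup N) ι b)
    have hmul : resGalSubgroupOfEmb (κ.layerSubgroup N) ι (a * b) =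
        resGalSubgroupOfEmb (κ.layerSubgroup N) ι a * resGalSubgroupOfEmb (κ.layerSubgroup N) ι b := map_mul _ _ _
    change pointsMapOfEmb W ι ((φN.1 (resGalSubgroupOfEmb (κ.layerSubgroup N) ι (a * b)) : W.geomPrimaryTorsion p) :
        W.geomPoints) - (((a * b : UN) : absoluteGaloisGroup E) • Q' - Q') =
      (pointsMapOfEmb W ι ((φN.1 (resGalSubgroupOfEmb (κ.layerSubgroup N) ι a) : W.geomPrimaryTorsion p) : W.geomPoints) -
          ((a : absoluteGaloisGroup E) • Q' - Q')) +
        a • (pointsMapOfEmb W ι ((φN.1 (resGalSubgroupOfEmb (κ.layerSubgroup N) ι b) : W.geomPrimaryTorsion p) :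
            W.geomPoints) - ((b : absoluteGaloisGroup E) • Q' - Q'))
    rw [hmul, hcoc, AddMemClass.coe_add, map_add]
    have hact : (((discreteTopRep (κ.layerSubgroup N) (W.geomPrimaryTorsion p)).ρ
        (resGalSubgroupOfEmb (κ.layerSubgroup N) ι a))
          (φN.1 (resGalSubgroupOfEmb (κ.layerSubgroup N) ι b)) : W.geomPoints) =
        resGalOfEmb ι (a : absoluteGaloisGroup E) •
          ((φN.1 (resGalSubgroupOfEmb (κ.layerSubgroup N) ι b) : W.geomPrimaryTorsion p) : W.geomPoints) := rfl
    rw [hact, pointsMapOfEmb_smul, Subgroup.coe_mul, mul_smul, Subgroup.smul_def, smul_sub, smul_sub]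
    abel
  -- `δ` vanishes on `U_∞`
  have hδ_inf : ∀ τ : UN, τ ∈ Uinf.subgroupOf UN → δ τ = 0 := by
    intro τ hτ
    rw [Subgroup.mem_subgroupOf] at hτ
    have hg : resGalOfEmb ι (τ : absoluteGaloisGroup E) ∈ κ.kerSubgroup := (mem_localSubgroupOfEmb_iff _ _ _).1 hτ
    have e : resGalSubgroupOfEmb (κ.layerSubgroup N) ι τ =
        subgroupInclusion hle (resGalSubgroupOfEmb κ.kerSubgroup ι ⟨(τ : absoluteGaloisGroup E), hτ⟩) :=
      Subtype.ext rfl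
    have h1 := hw ⟨(τ : absoluteGaloisGroup E), hτ⟩
    rw [hφ] at h1
    change pointsMapOfEmb W ι ((φN.1 (resGalSubgroupOfEmb (κ.layerSubgroup N) ι τ) : W.geomPrimaryTorsion p) :
        W.geomPoints) - ((τ : absoluteGaloisGroup E) • Q' - Q') = 0
    rw [e, sub_eq_zero, hQ', hR', smul_sub, ← pointsMapOfEmb_smul]
    rw [map_add, map_sub] at h1
    have h1' := h1
    -- `h1' : ι φN + (ι(σR) - ιR) = τQ - Q`
    change pointsMapOfEmb W ι _ + (pointsMapOfEmb W ι (resGalOfEmb ι (τ : absoluteGaloisGroup E) • (R : W.geomPoints)) -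
        pointsMapOfEmb W ι (R : W.geomPoints)) = (τ : absoluteGaloisGroup E) • Q - Q at h1'
    rw [← eq_sub_iff_add_eq] at h1'
    rw [h1']
    abel
  -- hence `δ` is `U_∞`-fixed (§1), i.e. lands in `E(K_∞·E)`
  haveI hUn : Uinf.Normal :=
    Subgroup.Normal.comap (inferInstance : κ.kerSubgroup.Normal) (resGalOfEmb ι).toMonoidHom
  haveI : (Uinf.subgroupOf UN).Normal := hUn.subgroupOf UN
  have hfix : ∀ τ : UN, δ τ ∈ localTowerPointsOfEmb κ ι W := by
    intro τ
    rw [mem_localTowerPointsOfEmb_iff]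
    intro σ hσ
    have h := smul_eq_self_of_crossedHom_of_forall_mem_eq_zero (Uinf.subgroupOf UN) δ hδ_cross hδ_inf τ
      (v := ⟨σ, hUle hσ⟩) (by rw [Subgroup.mem_subgroupOf]; exact hσ)
    exact h
  -- and `δ` is torsion-valued
  obtain ⟨a, ha⟩ := (AddCommGroup.mem_primaryComponent).1 R.2
  have haR' : (p ^ a : ℕ) • R' = 0 := by rw [hR', ← map_nsmul, ha, map_zero]
  have hδ_tors : ∀ τ : UN, ∃ j : ℕ, (p ^ j : ℕ) • δ τ = 0 := by
    intro τ
    obtain ⟨b, hb⟩ := (AddCommGroup.mem_primaryComponent).1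
      (φN.1 (resGalSubgroupOfEmb (κ.layerSubgroup N) ι τ) : W.geomPrimaryTorsion p).2
    have hQfix : (τ : absoluteGaloisGroup E) • ((p ^ k : ℕ) • Q) = (p ^ k : ℕ) • Q :=
      (mem_localLayerPointsOfEmb_iff κ ι W N _).1 hQN _ τ.2
    have hA : (p ^ k : ℕ) • ((τ : absoluteGaloisGroup E) • Q - Q) = 0 := by
      rw [nsmul_sub, smul_comm, hQfix, sub_self]
    have hB : (p ^ a : ℕ) • ((τ : absoluteGaloisGroup E) • R' - R') = 0 := by
      rw [nsmul_sub, smul_comm, haR', smul_zero, sub_self]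
    have hE : (τ : absoluteGaloisGroup E) • Q' - Q' =
        ((τ : absoluteGaloisGroup E) • Q - Q) - ((τ : absoluteGaloisGroup E) • R' - R') := by
      rw [hQ', smul_sub]; abel
    have h2 : (p ^ (k + a) : ℕ) • ((τ : absoluteGaloisGroup E) • Q' - Q') = 0 := by
      rw [hE, nsmul_sub, pow_add, mul_nsmul, hA, nsmul_zero, mul_comm, mul_nsmul, hB, nsmul_zero, sub_self]
    have hC : (p ^ b : ℕ) • pointsMapOfEmb W ι ((φN.1 (resGalSubgroupOfEmb (κ.layerSubgroup N) ι τ) :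
        W.geomPrimaryTorsion p) : W.geomPoints) = 0 := by
      rw [← map_nsmul, hb, map_zero]
    refine ⟨b + (k + a), ?_⟩
    change (p ^ (b + (k + a)) : ℕ) • (pointsMapOfEmb W ι ((φN.1 (resGalSubgroupOfEmb (κ.layerSubgroup N) ι τ) :
        W.geomPrimaryTorsion p) : W.geomPoints) - ((τ : absoluteGaloisGroup E) • Q' - Q')) = 0
    rw [nsmul_sub, pow_add, mul_nsmul, hC, nsmul_zero, mul_comm, mul_nsmul, h2, nsmul_zero, sub_self]
  -- so `δ = 0`
  intro τ
  obtain ⟨j, hj⟩ := hδ_tors τ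
  have h0 : δ τ = 0 := hTF _ (hfix τ) j hj
  have h1 := sub_eq_zero.1 h0
  rw [hQ', hR'] at h1
  exact h1

end Descent

/-! ## §4 The packaged form at `p = 2` on the habitat -/

section Two

variable (W : WeierstrassCurve ℚ) [W.IsElliptic] [W.IsGloballyMinimal]

/-- **Layer Kummer witness for `Sel^ε(E/ℚ_∞)` at the prime above `2`.** `W/ℚ` globally minimal with `GoodSS W 2`, `κ` a
`ℤ₂`-extension, `v ∋ 2`, `ι = closureEmb`: for `t ∈ Sel^ε(E/ℚ_∞)`, a crossed homomorphism `φ` of class `t` with Kummer witness `Q`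
over `ℚ_∞` (`ι φ(τ|_ℚ̄) = τQ − Q` on `Gal(ℚ̄_v/ℚ_∞·ℚ_v)`), and `n₀`, `k` with `2^k Q ∈ E(ℚ_{n₀}·ℚ_v)`: there are a layer `N ≥ n₀`, a
class `t_N ∈ Sel^ε(E/ℚ_N)` with `res t_N = t`, and for EVERY crossed homomorphism `φ_N` of class `t_N` a `2`-power torsion point
`R ∈ E(ℚ̄)` with `ι φ_N(τ|_ℚ̄) = τ(Q − ιR) − (Q − ιR)` for all `τ ∈ Gal(ℚ̄_v/ℚ_N·ℚ_v)`, and one exponent `K` with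
`2^K φ_N = 0` pointwise. This is the Selmer-side input of Poitou–Tate at layer `N` for (PT-orth).
[cite: Kobayashi2003, Def. 1.1 (p. 2), (7.16)–(7.21) (p. 12), Prop. 8.7 (p. 16)] [cite: GreenbergLNM1716, §3 Lemma 3.1 (p. 86)] -/
theorem exists_signedSelmerLayer_kummerWitness_two (hss : Rank1Residual.GoodSS W 2) (κ : ZpExtension ℚ 2) (ε : ℤˣ)
    {v : HeightOneSpectrum (𝓞 ℚ)} (hv : (2 : 𝓞 ℚ) ∈ v.asIdeal)
    {t : W.subgroupH1 2 κ.kerSubgroup} (ht : t ∈ signedSelmerInfty W κ ε)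
    (φ : contOneCocycles (discreteTopRep κ.kerSubgroup (W.geomPrimaryTorsion 2)))
    (hφ : oneCocycleClass _ φ = t) (Q : localPoints W (v.adicCompletion ℚ)) (n₀ k : ℕ)
    (hQ : (2 ^ k : ℕ) • Q ∈ localLayerPointsOfEmb κ (closureEmb (K := ℚ) (v.adicCompletion ℚ)) W n₀)
    (hw : ∀ τ : localSubgroupOfEmb κ.kerSubgroup (closureEmb (K := ℚ) (v.adicCompletion ℚ)),
      pointsMapOfEmb W (closureEmb (K := ℚ) (v.adicCompletion ℚ))
          ((φ.1 (resGalSubgroupOfEmb κ.kerSubgroup _ τ) : W.geomPrimaryTorsion 2) : W.geomPoints) =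
        (τ : absoluteGaloisGroup (v.adicCompletion ℚ)) • Q - Q) :
    ∃ (N : ℕ) (_ : n₀ ≤ N) (tN : W.subgroupH1 2 (κ.layerSubgroup N)),
      tN ∈ signedSelmerLayer W κ ε N ∧ W.layerToInfty κ N tN = t ∧
      ∀ φN : contOneCocycles (discreteTopRep (κ.layerSubgroup N) (W.geomPrimaryTorsion 2)),
        oneCocycleClass _ φN = tN →
        (∃ K : ℕ, ∀ x, (2 ^ K : ℕ) • ((φN.1 x : W.geomPrimaryTorsion 2) : W.geomPoints) = 0) ∧
        ∃ R : W.geomPrimaryTorsion 2,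
          ∀ τ : localSubgroupOfEmb (κ.layerSubgroup N) (closureEmb (K := ℚ) (v.adicCompletion ℚ)),
            pointsMapOfEmb W (closureEmb (K := ℚ) (v.adicCompletion ℚ))
                ((φN.1 (resGalSubgroupOfEmb (κ.layerSubgroup N) _ τ) : W.geomPrimaryTorsion 2) : W.geomPoints) =
              (τ : absoluteGaloisGroup (v.adicCompletion ℚ)) •
                  (Q - pointsMapOfEmb W (closureEmb (K := ℚ) (v.adicCompletion ℚ)) (R : W.geomPoints)) -
                (Q - pointsMapOfEmb W (closureEmb (K := ℚ) (v.adicCompletion ℚ)) (R : W.geomPoints)) := by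
  -- descend `t` to a layer `n`, then to `N = max n n₀`
  obtain ⟨n, c, hc, hct⟩ := SignedEC.exists_layer_of_mem_signedSelmerInfty W κ ε ht
  let N := max n n₀
  let tN : W.subgroupH1 2 (κ.layerSubgroup N) := W.resOfLe 2 (κ.layerSubgroup_antitone (le_max_left n n₀)) c
  have htN : tN ∈ signedSelmerLayer W κ ε N := SignedEC.resOfLe_mem_signedSelmerLayer W κ ε (le_max_left n n₀) hc
  have htNt : W.layerToInfty κ N tN = t := by
    rw [← hct]; exact FineSelmerLeSignedSelmer.layerToInfty_resOfLe_layer W κ (le_max_left n n₀) c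
  refine ⟨N, le_max_right n n₀, tN, htN, htNt, fun φN hφN ↦ ⟨?_, ?_⟩⟩
  · haveI : CompactSpace (absoluteGaloisGroup ℚ) := absoluteGaloisGroup_compactSpace ℚ
    haveI : CompactSpace ↥(κ.layerSubgroup N) := isCompact_iff_compactSpace.mp
      (Subgroup.isClosed_of_isOpen _ (κ.isOpen_layerSubgroup N)).isCompact
    exact exists_pow_nsmul_apply_eq_zero_of_compactSpace W 2 φN
  · refine exists_torsion_kummerWitness_layer W κ (closureEmb (K := ℚ) (v.adicCompletion ℚ))
      (fun P hP j hj ↦ LocalTowerRes.eq_zero_of_mem_localTowerPointsOfEmb_of_pow_nsmul_two W hss κ hv _ j hP hj)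
      φN φ ?_ Q k (localLayerPointsOfEmb_mono κ _ W (le_max_right n n₀) hQ) hw
    rw [hφN, htNt, hφ]

end Two

end SignedKatoOffTwo.LayerWitness

end Summit.BirchSwinnertonDyer.BirchSwinnertonDyer.Theorems

end
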